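import Mathlib.LinearAlgebra.Matrix.Rank
import Mathlib.LinearAlgebra.Matrix.NonsingularInverse
import Mathlib.LinearAlgebra.Matrix.Block
import Mathlib.Data.ZMod.Basic
import Mathlib.Algebra.Field.ZMod
import HarnessLib

/-!
# Kernel-checkable sparse LU certificates for lower bounds on matrix rank

Topic `Literature/Computability/AlgebraicComplexity` (support for the computational rank facts of
`BorderRankCWKoszulRanks.lean`, Conner–Gesmundo–Landsberg–Ventura 2022, Thm. 1.2 / Thm. 3.3).
A standard device, PROVED here once: to certify `k ≤ rank A` for an integer matrix `A` (viewed over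
a field of characteristic `0`) one names `k` rows `r`, `k` columns `c`, a prime `pr`, and sparse
factors `L` (unit lower triangular) and `U` (upper triangular, nonzero diagonal) with
`L · U ≡ A[r, c] (mod pr)`; then `det A[r,c] ≢ 0 (mod pr)`, so `det A[r,c] ≠ 0` and `rank A ≥ k`.

* `alistVal` — lookup in an association list `List (ℕ × ℕ)` (first hit, default `0`).
* `luU`, `luProd`, `luCheck k pr entry L U : Bool` — the checker: for all `i, j < k`,
  `U i j + ∑_{(s,v) ∈ L i} v · U s j ≡ entry i j (mod pr)` (the `(i, j)` entry of `L · U`, computed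
  sparsely), the diagonal of `U` is `≢ 0`, and the keys of each `L i` are distinct and `< i`.  The
  factors are `Fin k → List (ℕ × ℕ)` (row `i` of `L` below the diagonal; row `s` of `U` from the
  diagonal on, keyed by column); `entry : Fin k → Fin k → ℤ` is any (cheaply evaluable) function.
  The checker is meant to be run by `decide` (kernel reduction): its cost is
  `k² · (cost of entry) + ∑ᵢ |L i| · |U ·|`, not `k³`.
* `det_ne_zero_of_luCheck` — soundness: `luCheck = true ⇒ det (Matrix.of entry) ≠ 0` over `ℤ`.
* `le_rank_map_of_luCheck` — the rank form: if `entry i j = A (r i) (c j)` then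
  `k ≤ rank (A.map Int.cast)` over any field of characteristic `0`.

[folklore] throughout (LU decomposition; `det` multiplicative; a nonzero minor bounds the rank).
-/

namespace Literature.Computability.AlgebraicComplexity

open Matrix

/-! ## The checker (computable) -/

/-- Lookup in an association list of naturals: the value attached to the first occurrence of the
key `s`, or `0`. [folklore] -/
def alistVal : List (ℕ × ℕ) → ℕ → ℕ
  | [], _ => 0
  | (a, v) :: l, s => if a = s then v else alistVal l s

section Checker

variable (k : ℕ)

/-- Entry `(s, j)` of the upper factor: the lookup in row `s` of `U`, and `0` below the diagonal or
outside the index range. [folklore] -/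
def luU (U : Fin k → List (ℕ × ℕ)) (s j : ℕ) : ℕ :=
  if h : s < k then (if s ≤ j then alistVal (U ⟨s, h⟩) j else 0) else 0

/-- Entry `(i, j)` of `L · U` for a UNIT lower triangular `L` given by its strictly-lower rows,
computed sparsely: `U i j + ∑_{(s, v) ∈ L i} v · U s j` (in `ℕ`, before reduction mod `pr`).
[folklore] -/
def luProd (L U : Fin k → List (ℕ × ℕ)) (i : Fin k) (j : ℕ) : ℕ :=
  luU k U i j + ((L i).map fun sv => sv.2 * luU k U sv.1 j).sum

variable (pr : ℕ)

/-- **The certificate checker**: `L · U ≡ entry (mod pr)` entrywise, `U` has nonzero diagonal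
mod `pr`, and the keys of each row of `L` are distinct and strictly below the diagonal. [folklore] -/
def luCheck (entry : Fin k → Fin k → ℤ) (L U : Fin k → List (ℕ × ℕ)) : Bool :=
  (List.finRange k).all fun i =>
    decide ((L i).map Prod.fst).Nodup && (L i).all (fun sv => decide (sv.1 < i.val)) &&
      !decide (alistVal (U i) i % pr = 0) &&
        (List.finRange k).all fun j => decide ((luProd k L U i j : ℤ) % pr = entry i j % pr)

end Checker

/-! ## Soundness -/

section Soundness

variable {k pr : ℕ}

/-- A key that does not occur is looked up as `0`. [folklore] -/
theorem alistVal_eq_zero_of_not_mem {l : List (ℕ × ℕ)} {s : ℕ} (h : s ∉ l.map Prod.fst) :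
    alistVal l s = 0 := by
  induction l with
  | nil => rfl
  | cons av l ih =>
    obtain ⟨a, v⟩ := av
    simp only [List.map_cons, List.mem_cons, not_or] at h
    simp only [alistVal, if_neg (Ne.symm h.1)]
    exact ih h.2

/-- The sparse sum over an association list equals the dense sum over all keys below `i`.
[folklore] -/
theorem sum_ite_alistVal_mul {R : Type*} [CommRing R] (i : Fin k) (g : ℕ → ℕ) :
    ∀ l : List (ℕ × ℕ), (l.map Prod.fst).Nodup → (∀ sv ∈ l, sv.1 < i.val) →
      (∑ s : Fin k, if s.val < i.val then ((alistVal l s.val : ℕ) : R) * (g s.val : R) else 0) =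
        (((l.map fun sv => sv.2 * g sv.1).sum : ℕ) : R)
  | [], _, _ => by simp [alistVal]
  | (a, v) :: l, hnd, hlt => by
    have hnd' : a ∉ l.map Prod.fst ∧ (l.map Prod.fst).Nodup := by
      simpa [List.map_cons, List.nodup_cons] using hnd
    have ha : a < i.val := hlt (a, v) (by simp)
    have hak : a < k := ha.trans i.isLt
    have ih := sum_ite_alistVal_mul (R := R) i g l hnd'.2 fun sv hsv => hlt sv (by simp [hsv])
    simp only [List.map_cons, List.sum_cons, Nat.cast_add, Nat.cast_mul]
    rw [← ih]
    -- split off the term `s = a`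
    have key : ∀ s : Fin k, (if s.val < i.val then ((alistVal ((a, v) :: l) s.val : ℕ) : R) * (g s.val : R)
        else 0) = (if s = ⟨a, hak⟩ then (v : R) * (g a : R) else 0) +
          (if s.val < i.val then ((alistVal l s.val : ℕ) : R) * (g s.val : R) else 0) := by
      intro s
      by_cases hs : s = ⟨a, hak⟩
      · subst hs
        simp [alistVal, ha, alistVal_eq_zero_of_not_mem hnd'.1]
      · have hs' : a ≠ s.val := fun h => hs (Fin.ext h.symm)
        simp [alistVal, hs, hs']
    rw [Finset.sum_congr rfl fun s _ => key s, Finset.sum_add_distrib, Finset.sum_ite_eq']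
    simp

/-- **Soundness of the checker**: if `luCheck k pr entry L U = true` for a prime `pr`, then
`det (Matrix.of entry) ≠ 0` (over `ℤ`). [folklore] -/
theorem det_ne_zero_of_luCheck [hp : Fact pr.Prime] {entry : Fin k → Fin k → ℤ}
    {L U : Fin k → List (ℕ × ℕ)} (h : luCheck k pr entry L U = true) :
    (Matrix.of fun i j => entry i j).det ≠ 0 := by
  classical
  -- unpack the Boolean checker
  have hrow : ∀ i : Fin k, ((L i).map Prod.fst).Nodup ∧ (∀ sv ∈ L i, sv.1 < i.val) ∧
      alistVal (U i) i % pr ≠ 0 ∧ ∀ j : Fin k, (luProd k L U i j : ℤ) % pr = entry i j % pr := by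
    intro i
    have hi := List.all_eq_true.1 h i (List.mem_finRange i)
    simp only [Bool.and_eq_true, decide_eq_true_eq, List.all_eq_true, Bool.not_eq_true',
      decide_eq_false_iff_not] at hi
    exact ⟨hi.1.1.1, fun sv hsv => hi.1.1.2 sv hsv, hi.1.2, fun j => hi.2 j (List.mem_finRange j)⟩
  -- the two factors over `ZMod pr`
  let Lm : Matrix (Fin k) (Fin k) (ZMod pr) := fun i s =>
    if s.val < i.val then ((alistVal (L i) s.val : ℕ) : ZMod pr) else if s = i then 1 else 0
  let Um : Matrix (Fin k) (Fin k) (ZMod pr) := fun s j => ((luU k U s.val j.val : ℕ) : ZMod pr)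
  have hLm : ∀ i s : Fin k, Lm i s =
      if s.val < i.val then ((alistVal (L i) s.val : ℕ) : ZMod pr) else if s = i then 1 else 0 :=
    fun _ _ => rfl
  have hUm : ∀ s j : Fin k, Um s j =
      if s.val ≤ j.val then ((alistVal (U s) j.val : ℕ) : ZMod pr) else 0 := by
    intro s j
    change ((luU k U s.val j.val : ℕ) : ZMod pr) = _
    simp only [luU, dif_pos s.isLt]
    split_ifs <;> simp
  -- `U` is upper triangular with nonzero diagonal
  have hUtri : Um.BlockTriangular id := by
    intro s j hjs
    have hjs' : j.val < s.val := hjs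
    rw [hUm, if_neg (not_le.2 hjs')]
  have hUdet : Um.det ≠ 0 := by
    rw [Matrix.det_of_upperTriangular hUtri]
    refine Finset.prod_ne_zero_iff.2 fun i _ => ?_
    rw [hUm, if_pos le_rfl, Ne, ZMod.natCast_eq_zero_iff]
    intro hd
    exact (hrow i).2.2.1 (Nat.mod_eq_zero_of_dvd hd)
  -- `L` is unit lower triangular
  have hLtri : Lm.BlockTriangular OrderDual.toDual := by
    intro i s his
    have his' : i.val < s.val := his
    rw [hLm, if_neg (by omega), if_neg (fun h => by rw [h] at his'; exact lt_irrefl _ his')]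
  have hLdet : Lm.det = 1 := by
    rw [Matrix.det_of_lowerTriangular Lm hLtri]
    refine Finset.prod_eq_one fun i _ => ?_
    rw [hLm, if_neg (lt_irrefl _), if_pos rfl]
  -- `L · U = entry (mod pr)`
  have hLU : Lm * Um = (Matrix.of fun i j => entry i j).map (Int.castRingHom (ZMod pr)) := by
    ext i j
    rw [Matrix.mul_apply, Matrix.map_apply, Matrix.of_apply, eq_intCast]
    have hsplit : ∀ s : Fin k, Lm i s * Um s j = (if s = i then Um i j else 0) +
        (if s.val < i.val then
          ((alistVal (L i) s.val : ℕ) : ZMod pr) * ((luU k U s.val j.val : ℕ) : ZMod pr) else 0) := by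
      intro s
      by_cases hs : s = i
      · subst hs
        rw [hLm, if_neg (lt_irrefl _), if_pos rfl, if_pos rfl, if_neg (lt_irrefl _), one_mul, add_zero]
      · by_cases hlt : s.val < i.val
        · rw [hLm, if_pos hlt, if_neg hs, if_pos hlt, zero_add]
        · rw [hLm, if_neg hlt, if_neg hs, if_neg hs, if_neg hlt, zero_mul, add_zero]
    rw [Finset.sum_congr rfl fun s _ => hsplit s, Finset.sum_add_distrib, Finset.sum_ite_eq']
    simp only [Finset.mem_univ, if_true]
    rw [sum_ite_alistVal_mul i (fun s => luU k U s j.val) (L i) (hrow i).1 (hrow i).2.1]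
    have hmod := (hrow i).2.2.2 j
    have hcast : ((luProd k L U i j : ℤ) : ZMod pr) = ((entry i j : ℤ) : ZMod pr) :=
      (ZMod.intCast_eq_intCast_iff' _ _ _).2 hmod
    rw [Int.cast_natCast] at hcast
    rw [← hcast]
    simp only [luProd, Nat.cast_add]
    rfl
  -- conclude
  intro hdet
  have h1 : ((Matrix.of fun i j => entry i j).map (Int.castRingHom (ZMod pr))).det = 0 := by
    rw [← RingHom.mapMatrix_apply, ← RingHom.map_det, hdet, map_zero]
  rw [← hLU, Matrix.det_mul, hLdet, one_mul] at h1
  exact hUdet h1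

/-- **The rank certificate**: if the checker accepts `entry = A[r, c]` then `k ≤ rank A` for the
integer matrix `A` read in any field of characteristic `0` (a `k × k` minor of `A` is nonzero
mod `pr`, hence nonzero). [folklore] -/
theorem le_rank_map_of_luCheck {K : Type*} [Field K] [CharZero K] {m n : Type*} [Fintype m]
    [Fintype n] [DecidableEq m] [DecidableEq n] (A : Matrix m n ℤ) {pr : ℕ} [Fact pr.Prime] {k : ℕ}
    (entry : Fin k → Fin k → ℤ) (r : Fin k → m) (c : Fin k → n)
    (hA : ∀ i j, entry i j = A (r i) (c j)) (L U : Fin k → List (ℕ × ℕ))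
    (h : luCheck k pr entry L U = true) : k ≤ (A.map (Int.castRingHom K)).rank := by
  have hdet := det_ne_zero_of_luCheck h
  have hsub : (Matrix.of fun i j => entry i j) = A.submatrix r c := by
    ext i j
    exact hA i j
  rw [hsub] at hdet
  have hdetK : ((A.map (Int.castRingHom K)).submatrix r c).det ≠ 0 := by
    rw [show (A.map (Int.castRingHom K)).submatrix r c = (A.submatrix r c).map (Int.castRingHom K)
      from rfl, ← RingHom.mapMatrix_apply, ← RingHom.map_det, Ne, eq_intCast, Int.cast_eq_zero]
    exact hdet
  have hunit : IsUnit ((A.map (Int.castRingHom K)).submatrix r c) :=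
    (Matrix.isUnit_iff_isUnit_det _).2 (isUnit_iff_ne_zero.2 hdetK)
  have hrank := Matrix.rank_of_isUnit _ hunit
  rw [Fintype.card_fin] at hrank
  calc k = ((A.map (Int.castRingHom K)).submatrix r c).rank := hrank.symm
    _ ≤ (A.map (Int.castRingHom K)).rank := Matrix.rank_submatrix_le _ _ _

end Soundness

end Literature.Computability.AlgebraicComplexity
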